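import Mathlib
import Summits.Ventures.PercRepro2.Defs
import Summits.Ventures.PercRepro2.Graph
import Summits.Ventures.PercRepro2.Events
import Summits.Ventures.PercRepro2.Induced
import Summits.Ventures.PercRepro2.Frontier
import Summits.Ventures.PercRepro2.BHKEvents
import Summits.Ventures.PercRepro2.BTVFamilyDefs
import Summits.Ventures.PercRepro2.BTVFamilyReveal
import Summits.Ventures.PercRepro2.BlockConn
import Summits.Ventures.PercRepro2.BlockFamilyDefs

/-!
# The block family: revealing a frontier vertex of each cell (blind cell PercRepro2, mine-1 g53;
paper proofs/MINE1-BLOCKS.md §2.3 (F3))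

For a vertex `z` of a frontier set of a cell, the cell on `G[U]` is, pointwise in the
configuration `ω`, the same cell on `G[U ∖ z]` with `z` replaced by its open neighbours
`frontier ends U {z} ω` in the frontier set that contained it — and, for a block vertex of
`b` or `j`, with the blocks through `z` merged into one block carrying the open neighbours
(`revealBlocks`).  Eight lemmas, one per cell and type of `z` (the `a`/`m` cases are those of
`BTVFamilyReveal.lean` with a set `Vs` of observed vertices).
-/

namespace Summit.Ventures.PercRepro2

namespace BlockFamily

open BTVFamily

section RevealCells

variable {V : Type*} {E : Type*} [Fintype E] [DecidableEq V] {ends : E → Sym2 V} {U : Finset V}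
  {z : V} {ω : Config E}

variable (hzU : z ∈ U) {s t : V} (hzs : z ≠ s) (hzt : z ≠ t) {Vs : Finset V} (hzv : z ∉ Vs)
include hzU hzs hzt hzv

omit [Fintype E] hzU hzs hzt hzv in
/-- Connections from `s` in `G[U]` are connections in `G[U ∖ z]` when `s` avoids `z`. -/
lemma conn_sdiff_of_not_conn_z {x : V} (hsz : ¬ Conn ends (induced ends (↑U) ω) s z)
    (h : Conn ends (induced ends (↑U) ω) x s) : Conn ends (induced ends (↑(U \ {z})) ω) x s :=
  conn_symm (conn_induced_sdiff_of_conn (Z := {z})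
    (fun z' hz' => by rw [Finset.mem_singleton] at hz'; rw [hz']; exact hsz) (conn_symm h))

omit hzv in
/-- Cell `a`, `z` a `u`-vertex. -/
lemma aEv_reveal_A {A W : Finset V} (hzA : z ∈ A) (hzW : z ∉ W) :
    ω ∈ aEv ends U s t Vs A W ↔
      ω ∈ aEv ends (U \ {z}) s t Vs (A.erase z ∪ frontier ends U {z} ω) W := by
  have hzAW : z ∉ ({t} : Finset V) ∪ W := not_mem_union_of_ne hzt hzW
  have e3 : ConnSet ends (induced ends (↑U) ω) {s} ({t} ∪ A ∪ W) ↔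
      ConnSet ends (induced ends (↑(U \ {z})) ω) {s}
        ({t} ∪ (A.erase z ∪ frontier ends U {z} ω) ∪ W) := by
    rw [connSet_reveal' hzU (by simpa using hzs)
      (Finset.mem_union_left _ (Finset.mem_union_right _ hzA)),
      erase_union_right hzW, erase_union_left (by simpa using hzt)]
  have e4 : ConnSet ends (induced ends (↑U) ω) {t} A ↔
      ConnSet ends (induced ends (↑(U \ {z})) ω) {t} (A.erase z ∪ frontier ends U {z} ω) :=
    connSet_reveal' hzU (by simpa using hzt) hzA
  have e5 : ConnSet ends (induced ends (↑U) ω) W A ↔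
      ConnSet ends (induced ends (↑(U \ {z})) ω) W (A.erase z ∪ frontier ends U {z} ω) :=
    connSet_reveal' hzU hzW hzA
  constructor
  · rintro ⟨h1, h2, h3, h4, h5⟩
    have hsz : ¬ Conn ends (induced ends (↑U) ω) s z := fun h =>
      h3 ⟨s, Finset.mem_singleton_self s, z,
        Finset.mem_union_left _ (Finset.mem_union_right _ hzA), h⟩
    have htz : ¬ Conn ends (induced ends (↑U) ω) t z := fun h =>
      h4 ⟨t, Finset.mem_singleton_self t, z, hzA, h⟩
    refine ⟨fun v hv => conn_sdiff_of_not_conn_z hsz (h1 v hv), ?_, e3.not.1 h3,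
      e4.not.1 h4, e5.not.1 h5⟩
    exact (connSet_sdiff_of_not_conn_z (z := z) fun x hx => by
      rw [Finset.mem_singleton] at hx; rw [hx]; exact htz).1 h2
  · rintro ⟨h1, h2, h3, h4, h5⟩
    exact ⟨fun v hv => conn_of_conn_sdiff (h1 v hv), connSet_of_sdiff h2, e3.not.2 h3,
      e4.not.2 h4, e5.not.2 h5⟩

omit hzv in
/-- Cell `a`, `z` a `w`-vertex. -/
lemma aEv_reveal_W {A W : Finset V} (hzA : z ∉ A) (hzW : z ∈ W) :
    ω ∈ aEv ends U s t Vs A W ↔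
      ω ∈ aEv ends (U \ {z}) s t Vs A (W.erase z ∪ frontier ends U {z} ω) := by
  have hztA : z ∉ ({t} : Finset V) ∪ A := not_mem_union_of_ne hzt hzA
  have e2 : ConnSet ends (induced ends (↑U) ω) {t} W ↔
      ConnSet ends (induced ends (↑(U \ {z})) ω) {t} (W.erase z ∪ frontier ends U {z} ω) :=
    connSet_reveal' hzU (by simpa using hzt) hzW
  have e3 : ConnSet ends (induced ends (↑U) ω) {s} ({t} ∪ A ∪ W) ↔
      ConnSet ends (induced ends (↑(U \ {z})) ω) {s}
        ({t} ∪ A ∪ (W.erase z ∪ frontier ends U {z} ω)) := by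
    rw [connSet_reveal' hzU (by simpa using hzs) (Finset.mem_union_right _ hzW),
      erase_union_left hztA]
  have e5 : ConnSet ends (induced ends (↑U) ω) W A ↔
      ConnSet ends (induced ends (↑(U \ {z})) ω) (W.erase z ∪ frontier ends U {z} ω) A :=
    connSet_reveal hzU hzW hzA
  constructor
  · rintro ⟨h1, h2, h3, h4, h5⟩
    have hsz : ¬ Conn ends (induced ends (↑U) ω) s z := fun h =>
      h3 ⟨s, Finset.mem_singleton_self s, z, Finset.mem_union_right _ hzW, h⟩
    exact ⟨fun v hv => conn_sdiff_of_not_conn_z hsz (h1 v hv), e2.1 h2, e3.not.1 h3,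
      fun hc => h4 (connSet_of_sdiff hc), e5.not.1 h5⟩
  · rintro ⟨h1, h2, h3, h4, h5⟩
    refine ⟨fun v hv => conn_of_conn_sdiff (h1 v hv), e2.2 h2, e3.not.2 h3, ?_, e5.not.2 h5⟩
    rintro ⟨t', ht', a, ha, hta⟩
    rw [Finset.mem_singleton] at ht'
    subst ht'
    rcases conn_sdiff_or_conn_z (z := z) hta with h | h
    · exact h4 ⟨t', Finset.mem_singleton_self t', a, ha, h⟩
    · exact (e5.not.2 h5) ⟨z, hzW, a, ha, conn_trans (conn_symm h) hta⟩

omit hzv in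
/-- Cell `b`, `z` a block vertex: the blocks through `z` merge and carry the open neighbours. -/
lemma bEv_reveal_A {𝒰 : Finset (Finset V)} {W : Finset V} (hzA : z ∈ unionB 𝒰) (hzW : z ∉ W) :
    ω ∈ bEv ends U s t Vs 𝒰 W ↔
      ω ∈ bEv ends (U \ {z}) s t Vs (revealBlocks 𝒰 z (frontier ends U {z} ω)) W := by
  have hz : ∃ B ∈ 𝒰, z ∈ B := mem_unionB.1 hzA
  have e1 := forall_connSetB_reveal_iff (ends := ends) (ω := ω) (𝒰 := 𝒰) hzU (Ne.symm hzs) hz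
  have e3 : ConnSet ends (induced ends (↑U) ω) {t} ({s} ∪ unionB 𝒰 ∪ W) ↔
      ConnSet ends (induced ends (↑(U \ {z})) ω) {t}
        ({s} ∪ unionB (revealBlocks 𝒰 z (frontier ends U {z} ω)) ∪ W) := by
    rw [unionB_revealBlocks, connSet_reveal' hzU (by simpa using hzt)
      (Finset.mem_union_left _ (Finset.mem_union_right _ hzA)),
      erase_union_right hzW, erase_union_left (by simpa using hzs)]
  have e5 : ConnSet ends (induced ends (↑U) ω) (unionB 𝒰) W ↔
      ConnSet ends (induced ends (↑(U \ {z})) ω)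
        (unionB (revealBlocks 𝒰 z (frontier ends U {z} ω))) W := by
    rw [unionB_revealBlocks]
    exact connSet_reveal hzU hzA hzW
  constructor
  · rintro ⟨h1, h2, h3, h4, h5⟩
    have htz : ¬ Conn ends (induced ends (↑U) ω) t z := fun h =>
      h3 ⟨t, Finset.mem_singleton_self t, z,
        Finset.mem_union_left _ (Finset.mem_union_right _ hzA), h⟩
    refine ⟨e1.1 h1, fun v hv => conn_sdiff_of_not_conn_z htz (h2 v hv), e3.not.1 h3,
      fun hc => h4 (connSet_of_sdiff hc), e5.not.1 h5⟩
  · rintro ⟨h1, h2, h3, h4, h5⟩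
    refine ⟨e1.2 h1, fun v hv => conn_of_conn_sdiff (h2 v hv), e3.not.2 h3, ?_, e5.not.2 h5⟩
    rintro ⟨s', hs', w', hw', hsw⟩
    rw [Finset.mem_singleton] at hs'
    subst hs'
    rcases conn_sdiff_or_conn_z (z := z) hsw with h | h
    · exact h4 ⟨s', Finset.mem_singleton_self s', w', hw', h⟩
    · exact (e5.not.2 h5) ⟨z, hzA, w', hw', conn_trans (conn_symm h) hsw⟩

omit hzv in
/-- Cell `b`, `z` a `w`-vertex: the blocks are untouched. -/
lemma bEv_reveal_W {𝒰 : Finset (Finset V)} {W : Finset V} (hzA : z ∉ unionB 𝒰) (hzW : z ∈ W) :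
    ω ∈ bEv ends U s t Vs 𝒰 W ↔
      ω ∈ bEv ends (U \ {z}) s t Vs 𝒰 (W.erase z ∪ frontier ends U {z} ω) := by
  have hzsA : z ∉ ({s} : Finset V) ∪ unionB 𝒰 := not_mem_union_of_ne hzs hzA
  have e3 : ConnSet ends (induced ends (↑U) ω) {t} ({s} ∪ unionB 𝒰 ∪ W) ↔
      ConnSet ends (induced ends (↑(U \ {z})) ω) {t}
        ({s} ∪ unionB 𝒰 ∪ (W.erase z ∪ frontier ends U {z} ω)) := by
    rw [connSet_reveal' hzU (by simpa using hzt) (Finset.mem_union_right _ hzW),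
      erase_union_left hzsA]
  have e4 : ConnSet ends (induced ends (↑U) ω) {s} W ↔
      ConnSet ends (induced ends (↑(U \ {z})) ω) {s} (W.erase z ∪ frontier ends U {z} ω) :=
    connSet_reveal' hzU (by simpa using hzs) hzW
  have e5 : ConnSet ends (induced ends (↑U) ω) (unionB 𝒰) W ↔
      ConnSet ends (induced ends (↑(U \ {z})) ω) (unionB 𝒰)
        (W.erase z ∪ frontier ends U {z} ω) :=
    connSet_reveal' hzU hzA hzW
  constructor
  · rintro ⟨h1, h2, h3, h4, h5⟩
    have htz : ¬ Conn ends (induced ends (↑U) ω) t z := fun h =>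
      h3 ⟨t, Finset.mem_singleton_self t, z, Finset.mem_union_right _ hzW, h⟩
    have hsz : ¬ Conn ends (induced ends (↑U) ω) s z := fun h =>
      h4 ⟨s, Finset.mem_singleton_self s, z, hzW, h⟩
    have hbz : ∀ B ∈ 𝒰, ∀ b ∈ B, ¬ Conn ends (induced ends (↑U) ω) b z := fun B hB b hb h =>
      h5 ⟨b, subset_unionB hB hb, z, hzW, h⟩
    refine ⟨fun B hB => ?_, fun v hv => conn_sdiff_of_not_conn_z htz (h2 v hv),
      e3.not.1 h3, e4.not.1 h4, e5.not.1 h5⟩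
    obtain ⟨b, hb, hsb⟩ := connSetB_singleton_left.1 (h1 B hB)
    exact connSetB_singleton_left.2 ⟨b, hb, connB_sdiff_of_avoid hsz hbz hsb⟩
  · rintro ⟨h1, h2, h3, h4, h5⟩
    refine ⟨fun B hB => ?_, fun v hv => conn_of_conn_sdiff (h2 v hv), e3.not.2 h3, e4.not.2 h4,
      e5.not.2 h5⟩
    obtain ⟨b, hb, hsb⟩ := connSetB_singleton_left.1 (h1 B hB)
    exact connSetB_singleton_left.2 ⟨b, hb, connB_of_sdiff hsb⟩

/-- Cell `j`, `z` a block vertex (hence a frontier vertex). -/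
lemma jEv_reveal_A {A : Finset V} {𝒰 : Finset (Finset V)} {W : Finset V} (hzA : z ∈ A)
    (hzB : z ∈ unionB 𝒰) (hzW : z ∉ W) :
    ω ∈ jEv ends U s t Vs A 𝒰 W ↔
      ω ∈ jEv ends (U \ {z}) s t Vs (A.erase z ∪ frontier ends U {z} ω)
        (revealBlocks 𝒰 z (frontier ends U {z} ω)) W := by
  have hz : ∃ B ∈ 𝒰, z ∈ B := mem_unionB.1 hzB
  have e1 := forall_connSetB_reveal_iff (ends := ends) (ω := ω) (𝒰 := 𝒰) hzU (Ne.symm hzs) hz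
  have e2 : ∀ v ∈ Vs, (ConnB ends (induced ends (↑U) ω) 𝒰 v s ↔
      ConnB ends (induced ends (↑(U \ {z})) ω) (revealBlocks 𝒰 z (frontier ends U {z} ω)) v s) :=
    fun v hv => connB_reveal hzU (fun h => hzv (h ▸ hv)) (Ne.symm hzs)
  have e3 : ConnSet ends (induced ends (↑U) ω) {t} ({s} ∪ A ∪ W) ↔
      ConnSet ends (induced ends (↑(U \ {z})) ω) {t}
        ({s} ∪ (A.erase z ∪ frontier ends U {z} ω) ∪ W) := by
    rw [connSet_reveal' hzU (by simpa using hzt)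
      (Finset.mem_union_left _ (Finset.mem_union_right _ hzA)),
      erase_union_right hzW, erase_union_left (by simpa using hzs)]
  have e4 : ConnSet ends (induced ends (↑U) ω) ({s} ∪ A) W ↔
      ConnSet ends (induced ends (↑(U \ {z})) ω)
        ({s} ∪ (A.erase z ∪ frontier ends U {z} ω)) W := by
    rw [connSet_reveal hzU (Finset.mem_union_right _ hzA) hzW,
      erase_union_left (by simpa using hzs)]
  constructor
  · rintro ⟨h1, h2, h3, h4⟩
    exact ⟨e1.1 h1, fun v hv => (e2 v hv).1 (h2 v hv), e3.not.1 h3, e4.not.1 h4⟩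
  · rintro ⟨h1, h2, h3, h4⟩
    exact ⟨e1.2 h1, fun v hv => (e2 v hv).2 (h2 v hv), e3.not.2 h3, e4.not.2 h4⟩

omit hzv in
/-- Cell `j`, `z` a `w`-vertex (the blocks lie in the frontier `A`). -/
lemma jEv_reveal_W {A : Finset V} {𝒰 : Finset (Finset V)} (h𝒰 : unionB 𝒰 ⊆ A) {W : Finset V}
    (hzA : z ∉ A) (hzW : z ∈ W) :
    ω ∈ jEv ends U s t Vs A 𝒰 W ↔
      ω ∈ jEv ends (U \ {z}) s t Vs A 𝒰 (W.erase z ∪ frontier ends U {z} ω) := by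
  have hzsA : z ∉ ({s} : Finset V) ∪ A := not_mem_union_of_ne hzs hzA
  have e3 : ConnSet ends (induced ends (↑U) ω) {t} ({s} ∪ A ∪ W) ↔
      ConnSet ends (induced ends (↑(U \ {z})) ω) {t}
        ({s} ∪ A ∪ (W.erase z ∪ frontier ends U {z} ω)) := by
    rw [connSet_reveal' hzU (by simpa using hzt) (Finset.mem_union_right _ hzW),
      erase_union_left hzsA]
  have e4 : ConnSet ends (induced ends (↑U) ω) ({s} ∪ A) W ↔
      ConnSet ends (induced ends (↑(U \ {z})) ω) ({s} ∪ A)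
        (W.erase z ∪ frontier ends U {z} ω) :=
    connSet_reveal' hzU hzsA hzW
  constructor
  · rintro ⟨h1, h2, h3, h4⟩
    have hsz : ¬ Conn ends (induced ends (↑U) ω) s z := fun h =>
      h4 ⟨s, Finset.mem_union_left _ (Finset.mem_singleton_self s), z, hzW, h⟩
    have hbz : ∀ B ∈ 𝒰, ∀ b ∈ B, ¬ Conn ends (induced ends (↑U) ω) b z := fun B hB b hb h =>
      h4 ⟨b, Finset.mem_union_right _ (h𝒰 (subset_unionB hB hb)), z, hzW, h⟩
    refine ⟨fun B hB => ?_, fun v hv => connB_symm (connB_sdiff_of_avoid hsz hbz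
      (connB_symm (h2 v hv))), e3.not.1 h3, e4.not.1 h4⟩
    obtain ⟨b, hb, hsb⟩ := connSetB_singleton_left.1 (h1 B hB)
    exact connSetB_singleton_left.2 ⟨b, hb, connB_sdiff_of_avoid hsz hbz hsb⟩
  · rintro ⟨h1, h2, h3, h4⟩
    refine ⟨fun B hB => ?_, fun v hv => connB_of_sdiff (h2 v hv), e3.not.2 h3, e4.not.2 h4⟩
    obtain ⟨b, hb, hsb⟩ := connSetB_singleton_left.1 (h1 B hB)
    exact connSetB_singleton_left.2 ⟨b, hb, connB_of_sdiff hsb⟩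

omit hzv in
/-- Cell `m`, `z` a `u`-vertex. -/
lemma mEv_reveal_A {A W : Finset V} (hzA : z ∈ A) (hzW : z ∉ W) :
    ω ∈ mEv ends U s t Vs A W ↔
      ω ∈ mEv ends (U \ {z}) s t Vs (A.erase z ∪ frontier ends U {z} ω) W := by
  have hztW : z ∉ ({t} : Finset V) ∪ W := not_mem_union_of_ne hzt hzW
  have e3 : ConnSet ends (induced ends (↑U) ω) {s} ({t} ∪ A ∪ W) ↔
      ConnSet ends (induced ends (↑(U \ {z})) ω) {s}
        ({t} ∪ (A.erase z ∪ frontier ends U {z} ω) ∪ W) := by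
    rw [connSet_reveal' hzU (by simpa using hzs)
      (Finset.mem_union_left _ (Finset.mem_union_right _ hzA)),
      erase_union_right hzW, erase_union_left (by simpa using hzt)]
  have e4 : ConnSet ends (induced ends (↑U) ω) ({t} ∪ W) A ↔
      ConnSet ends (induced ends (↑(U \ {z})) ω) ({t} ∪ W)
        (A.erase z ∪ frontier ends U {z} ω) :=
    connSet_reveal' hzU hztW hzA
  constructor
  · rintro ⟨h1, h2, h3, h4⟩
    have htz : ¬ Conn ends (induced ends (↑U) ω) t z := fun h =>
      h4 ⟨t, Finset.mem_union_left _ (Finset.mem_singleton_self t), z, hzA, h⟩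
    refine ⟨(connSet_sdiff_of_not_conn_z (z := z) fun x hx => by
        rw [Finset.mem_singleton] at hx; rw [hx]; exact htz).1 h1, fun v hv => ?_, e3.not.1 h3,
      e4.not.1 h4⟩
    obtain ⟨v', hv', x, hx, hvx⟩ := h2 v hv
    rw [Finset.mem_singleton] at hv'
    subst hv'
    rcases conn_sdiff_or_conn_z (z := z) hvx with h | h
    · exact ⟨v', Finset.mem_singleton_self v', x, hx, h⟩
    · exact absurd ⟨x, hx, z, hzA, conn_trans (conn_symm hvx) h⟩ h4
  · rintro ⟨h1, h2, h3, h4⟩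
    exact ⟨connSet_of_sdiff h1, fun v hv => connSet_of_sdiff (h2 v hv), e3.not.2 h3, e4.not.2 h4⟩

/-- Cell `m`, `z` a `w`-vertex. -/
lemma mEv_reveal_W {A W : Finset V} (hzA : z ∉ A) (hzW : z ∈ W) :
    ω ∈ mEv ends U s t Vs A W ↔
      ω ∈ mEv ends (U \ {z}) s t Vs A (W.erase z ∪ frontier ends U {z} ω) := by
  have hztA : z ∉ ({t} : Finset V) ∪ A := not_mem_union_of_ne hzt hzA
  have e1 : ConnSet ends (induced ends (↑U) ω) {t} W ↔
      ConnSet ends (induced ends (↑(U \ {z})) ω) {t} (W.erase z ∪ frontier ends U {z} ω) :=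
    connSet_reveal' hzU (by simpa using hzt) hzW
  have e2 : ∀ v ∈ Vs, (ConnSet ends (induced ends (↑U) ω) {v} ({t} ∪ W) ↔
      ConnSet ends (induced ends (↑(U \ {z})) ω) {v}
        ({t} ∪ (W.erase z ∪ frontier ends U {z} ω))) := by
    intro v hv
    have hzv' : z ∉ ({v} : Finset V) := by
      rw [Finset.mem_singleton]
      exact fun h => hzv (h ▸ hv)
    rw [connSet_reveal' hzU hzv' (Finset.mem_union_right _ hzW), erase_union_left (by simpa using hzt)]
  have e3 : ConnSet ends (induced ends (↑U) ω) {s} ({t} ∪ A ∪ W) ↔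
      ConnSet ends (induced ends (↑(U \ {z})) ω) {s}
        ({t} ∪ A ∪ (W.erase z ∪ frontier ends U {z} ω)) := by
    rw [connSet_reveal' hzU (by simpa using hzs) (Finset.mem_union_right _ hzW),
      erase_union_left hztA]
  have e4 : ConnSet ends (induced ends (↑U) ω) ({t} ∪ W) A ↔
      ConnSet ends (induced ends (↑(U \ {z})) ω)
        ({t} ∪ (W.erase z ∪ frontier ends U {z} ω)) A := by
    rw [connSet_reveal hzU (Finset.mem_union_right _ hzW) hzA,
      erase_union_left (by simpa using hzt)]
  constructor
  · rintro ⟨h1, h2, h3, h4⟩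
    exact ⟨e1.1 h1, fun v hv => (e2 v hv).1 (h2 v hv), e3.not.1 h3, e4.not.1 h4⟩
  · rintro ⟨h1, h2, h3, h4⟩
    exact ⟨e1.2 h1, fun v hv => (e2 v hv).2 (h2 v hv), e3.not.2 h3, e4.not.2 h4⟩

end RevealCells

end BlockFamily

end Summit.Ventures.PercRepro2
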